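import Summits.ResolutionOfSingularities.ResolutionOfSingularities.Theorems.FrobeniusLadderFInjectiveMacaulayficationWeightedConeCore
import Summits.ResolutionOfSingularities.ResolutionOfSingularities.Theorems.FrobeniusLadderFInjectiveMacaulayficationWeightedChartClause
import HarnessLib

/-!
# The weighted cone engine (registered stub #23 of skeleton 10f06f91, line `Sketch`, §15)
# (crux `FInjectiveMacaulayfication`, stmt-ResolutionOfSingularities-15315)

Support file for crux stmt-ResolutionOfSingularities-15315 (`FrobeniusLadder.FInjectiveMacaulayfication`), chain w45a, lead seat
res-L1-w45a-lead-1. THE REGISTERED STUB `stub_weightedConeFiModel` (#23, lead c8's cycle-9 engine, signature verbatim): weights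
`w` with `N = c_v·w_v > 0`, the monomial ideal `I_N` of weighted degree `≥ N` with Veronese saturation, a prime `f` with all
`x̄_v ≠ 0`, root-cover identities `θ_v f = X_v^D g_v` with `g_v` weighted-homogeneous for `W = e_v − w (mod w_v)` and `X_v ∤ g_v`,
the clause for `R = k[X]/(f)` at the closed points off the origin and the clause for each μ-cover chart `k[X]/(g_v)` at its closed
points on `X_v = 0` ⇒ `Spec R` admits the crux's model (`affineBlowup (I_N R)`, the weighted blow-up of the origin).
PROOF = the core form `WeightedConeCore.weightedConeFiModel_of_chartClause` (p460946: E6‴ `BlowupFiModelOfCover` on the sub-cover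
`x̄_v^{c_v}`, `ReesCoverOfPowers` through the saturation, Jacobson off the centre) fed with the chart clause #22
`WeightedChartClause.stub_weightedChartClause` (μ-cover chart ≅ weight-`0̄` subalgebra by #20/#21, degree-`0̄` retraction and finite graded
descent). Calibration: #24 `F4WeightedFiModel` (separate file).
-/

set_option linter.dupNamespace false

open AlgebraicGeometry CategoryTheory Literature.AlgebraicGeometry.Resolution

namespace Summit.ResolutionOfSingularities.ResolutionOfSingularities.Theorems.FInjectiveMacaulayfication.WeightedConeFiModel

/-- **THE WEIGHTED CONE ENGINE** (registered stub `stub_weightedConeFiModel`, §15 #23 of line `Sketch`, crux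
stmt-ResolutionOfSingularities-15315; see the module docstring): the weighted blow-up `affineBlowup (I_N·R)` of an isolated bad point
of a hypersurface `R = k[X]/(f)` is an F-injective Macaulayfication as soon as `R` satisfies the clause off the origin and every
μ-cover chart `k[X]/(g_v)` satisfies it along `X_v = 0` — core p460946 composed with the chart clause #22. [folklore] -/
theorem stub_weightedConeFiModel : ∀ (p : ℕ) [Fact p.Prime] (k : Type) [Field k] [CharP k p] (n : ℕ) (w : Fin n → ℕ) (N D : ℕ) (c : Fin n → ℕ), 0 < N → (∀ v : Fin n, 0 < w v ∧ c v * w v = N) → (∀ (K : ℕ) (b : Fin n →₀ ℕ), K * N ≤ Finsupp.weight w b → (MvPolynomial.monomial b (1 : k) : MvPolynomial (Fin n) k) ∈ (Ideal.span {m : MvPolynomial (Fin n) k | ∃ b : Fin n →₀ ℕ, N ≤ Finsupp.weight w b ∧ m = MvPolynomial.monomial b 1}) ^ K) → ∀ (f : MvPolynomial (Fin n) k) (g : Fin n → MvPolynomial (Fin n) k), (Ideal.span {f}).IsPrime → (∀ v : Fin n, Ideal.Quotient.mk (Ideal.span {f}) (MvPolynomial.X v) ≠ 0) → (∀ v : Fin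 n, MvPolynomial.aeval (fun j : Fin n => if j = v then (MvPolynomial.X v : MvPolynomial (Fin n) k) ^ (w v) else MvPolynomial.X j * MvPolynomial.X v ^ (w j)) f = MvPolynomial.X v ^ D * g v) → (∀ v : Fin n, MvPolynomial.IsWeightedHomogeneous (fun j : Fin n => if j = v then (1 : ZMod (w v)) else -((w j : ℕ) : ZMod (w v))) (g v) (-((D : ℕ) : ZMod (w v)))) → (∀ v : Fin n, ¬ (MvPolynomial.X v : MvPolynomial (Fin n) k) ∣ g v) → (∀ (Q : Ideal (MvPolynomial (Fin n) k ⧸ Ideal.span {f})) [Q.IsMaximal], (∃ j : Fin n, Ideal.Quotient.mk (Ideal.span {f}) (MvPolynomial.X j) ∉ Q) → ∀ d : ℕ, ringKrullDim (Localization.AtPrime Q) = d → ∀ s : Fin d → Localization.AtPrime Q, (Ideal.span (Set.range s)).radical.IsMaximal → RingTheory.Sequence.IsWeaklyRegular (Localization.AtPrime Q) (List.ofFn s) ∧ ∀ y : Localization.AtPrime Q, (∃ e : ℕ, y ^ p ^ e ∈ Ideal.span ((fun z : Localization.AtPrime Q => z ^ p ^ e) '' (Ideal.span (Set.range s) : Set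 (Localization.AtPrime Q)))) → y ∈ Ideal.span (Set.range s)) → (∀ (v : Fin n) (Q : Ideal (MvPolynomial (Fin n) k ⧸ Ideal.span {g v})) [Q.IsMaximal], Ideal.Quotient.mk (Ideal.span {g v}) (MvPolynomial.X v) ∈ Q → ∀ d : ℕ, ringKrullDim (Localization.AtPrime Q) = d → ∀ s : Fin d → Localization.AtPrime Q, (Ideal.span (Set.range s)).radical.IsMaximal → RingTheory.Sequence.IsWeaklyRegular (Localization.AtPrime Q) (List.ofFn s) ∧ ∀ y : Localization.AtPrime Q, (∃ e : ℕ, y ^ p ^ e ∈ Ideal.span ((fun z : Localization.AtPrime Q => z ^ p ^ e) '' (Ideal.span (Set.range s) : Set (Localization.AtPrime Q)))) → y ∈ Ideal.span (Set.range s)) → ∃ (X' : Scheme.{0}) (π : X' ⟶ Spec (.of (MvPolynomial (Fin n) k ⧸ Ideal.span {f}))), IsProper π ∧ Literature.AlgebraicGeometry.Resolution.IsBirational π ∧ ∀ y : X', IsDomain (X'.presheaf.stalk y) ∧ ∀ d : ℕ, ringKrullDim (X'.presheaf.stalk y) = d → ∀ s : Fin d → X'.presheaf.stalk y, (Ideal.span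 (Set.range s)).radical.IsMaximal → RingTheory.Sequence.IsWeaklyRegular (X'.presheaf.stalk y) (List.ofFn s) ∧ ∀ z : X'.presheaf.stalk y, (∃ e : ℕ, z ^ p ^ e ∈ Ideal.span ((fun w : X'.presheaf.stalk y => w ^ p ^ e) '' (Ideal.span (Set.range s) : Set (X'.presheaf.stalk y)))) → z ∈ Ideal.span (Set.range s) := by
  intro p _ k _ _ n w N D c hN hwc hpow f g hfprime hXne hθ hhom hndvd hoff hon
  have hc : ∀ j : Fin n, 0 < c j := fun j => Nat.pos_of_ne_zero fun h => by
    have h2 := (hwc j).2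
    rw [h, zero_mul] at h2
    omega
  exact WeightedConeCore.weightedConeFiModel_of_chartClause p k n w N c hN hwc hpow f hfprime hXne hoff
    (fun v Q _ hQ => WeightedChartClause.stub_weightedChartClause p k n w v (hwc v).1 N (c v) D (hwc v).2 (hc v) hpow f (g v)
      (hθ v) (hhom v) (hndvd v) (hXne v) (hon v) Q hQ)

end Summit.ResolutionOfSingularities.ResolutionOfSingularities.Theorems.FInjectiveMacaulayfication.WeightedConeFiModel
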